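import Mathlib
import Summits.Ventures.HodgeRepro.Tier4.Common.CompactUnimodular

/-!
# Tier4/Common/CompactHaarProbability — the normalised Haar measure of a compact group: a Haar PROBABILITY measure,
right-invariant and inversion-invariant, exists on every compact group

Blind re-derivation cell `pub-hodge-repro`, Tier 4 «prove the step» (README §9–§10), seat t4-typer-2 (gen 3).
Target tree path `lean/Summits/Ventures/HodgeRepro/Tier4/Common/CompactHaarProbability.lean`.  Mathlib +
`Common.CompactUnimodular`; no literature.

WHY.  The `(C, χ)`-projector (KTypeProjector, KTypeProjectorAdjoint, KTypeProjectorCompose) takes the measure `ν`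
of the compact subgroup `C` as a parameter with `[ν.IsHaarMeasure] [IsProbabilityMeasure ν]`; a consumer that only
knows `C` is compact needs ONE such `ν` to exist.  Mathlib's `haarMeasure ⊤` normalised on the whole compact group
is it (`haarMeasure_self`, `TopologicalSpace.PositiveCompacts.coe_top`).

* `haarProb H := haarMeasure ⊤` — the normalised Haar measure of the compact group `H`;
* `isHaarMeasure_haarProb`, `isProbabilityMeasure_haarProb`, `isMulRightInvariant_haarProb`, `isInvInvariant_haarProb`
  (the last two from `CompactUnimodular`) — as THEOREMS (no instance declarations; consumers `haveI`);
* **`exists_isHaarMeasure_isProbabilityMeasure`** — `∃ ν, ν.IsHaarMeasure ∧ IsProbabilityMeasure ν` on a compact group.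

Nothing here says anything about the status of the Hodge conjecture for CM abelian varieties, which is NOT proved
(HC_CM is NOT proved by anyone in this repository).
-/

set_option autoImplicit false

noncomputable section

namespace Summit.Ventures.HodgeRepro.Tier4.Common

open MeasureTheory Measure Topology Set

section HaarProb

variable (H : Type*) [Group H] [TopologicalSpace H] [IsTopologicalGroup H] [CompactSpace H] [MeasurableSpace H]
  [BorelSpace H]

/-- **The normalised Haar measure of a compact group**: Mathlib's `haarMeasure` of the positive compact `⊤ = H`. -/
def haarProb : Measure H := haarMeasure (⊤ : TopologicalSpace.PositiveCompacts H)

/-- `haarProb H` is a Haar measure. -/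
theorem isHaarMeasure_haarProb : (haarProb H).IsHaarMeasure := by
  unfold haarProb
  infer_instance

/-- `haarProb H` is a probability measure (`haarMeasure ⊤ ⊤ = 1`). -/
theorem isProbabilityMeasure_haarProb : IsProbabilityMeasure (haarProb H) :=
  ⟨by rw [haarProb, ← TopologicalSpace.PositiveCompacts.coe_top, haarMeasure_self]⟩

/-- `haarProb H` is right-invariant (compact groups are unimodular, `CompactUnimodular`). -/
theorem isMulRightInvariant_haarProb : (haarProb H).IsMulRightInvariant := by
  haveI := isHaarMeasure_haarProb H
  exact isMulRightInvariant_of_compactSpace (haarProb H)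

/-- `haarProb H` is inversion-invariant (`CompactUnimodular`). -/
theorem isInvInvariant_haarProb : (haarProb H).IsInvInvariant := by
  haveI := isHaarMeasure_haarProb H
  exact isInvInvariant_of_compactSpace (haarProb H)

/-- **A Haar probability measure exists on every compact group.** -/
theorem exists_isHaarMeasure_isProbabilityMeasure : ∃ ν : Measure H, ν.IsHaarMeasure ∧ IsProbabilityMeasure ν :=
  ⟨haarProb H, isHaarMeasure_haarProb H, isProbabilityMeasure_haarProb H⟩

end HaarProb

section OfInvariant

variable {H : Type*} [Group H] [TopologicalSpace H] [IsTopologicalGroup H] [CompactSpace H] [MeasurableSpace H]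
  [BorelSpace H]

/-- **On a compact group a left-invariant probability measure is a Haar measure** (Mathlib's
`isHaarMeasure_of_isCompact_nonempty_interior` with `K := univ`): the glue between the instance pair
`[IsProbabilityMeasure ν] [ν.IsMulLeftInvariant]` of a consumer and the `[ν.IsHaarMeasure]` binders of
`integral_lProj_mul_eq` / `kProj_mem_of_isClosedSub`. -/
theorem isHaarMeasure_of_compactSpace_of_isMulLeftInvariant (ν : Measure H) [IsProbabilityMeasure ν]
    [ν.IsMulLeftInvariant] : ν.IsHaarMeasure :=
  isHaarMeasure_of_isCompact_nonempty_interior ν univ isCompact_univ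
    (by rw [interior_univ]; exact univ_nonempty) (by rw [measure_univ]; exact one_ne_zero)
    (by rw [measure_univ]; exact ENNReal.one_ne_top)

end OfInvariant

end Summit.Ventures.HodgeRepro.Tier4.Common

end
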